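import Summits.BirchSwinnertonDyer.BirchSwinnertonDyer.Theorems.ManinLocalTwoThreeHalfLatticeVeluAnyModel
import Summits.BirchSwinnertonDyer.BirchSwinnertonDyer.Theorems.ManinLocalTwoThreeThirdLatticeVelu
import Summits.BirchSwinnertonDyer.BirchSwinnertonDyer.Theorems.ManinLocalTwoThreeBlindTransferFourP
import Summits.BirchSwinnertonDyer.BirchSwinnertonDyer.Theorems.ManinLocalTwoThreeShimuraLedgerFourP
import HarnessLib

/-!
# The Γ₀/Γ₁ ledger at the prime-power tame levels `N = 4p^k` (`p` odd) and `N = 9p^k` (`p ≡ 2 (mod 3)` odd)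

Summit `BirchSwinnertonDyer`, route `ManinLocalTwoThree` (cell bsd-f2-manin), cruxes C2 `ManinOddAtFour` (stmt-…-22967) and
C3 `ManinPrimeToThreeAtNine` (stmt-…-22968).  The `N = 4q` / `N = 9q` theorems of this seat take `(ℤ/q)ˣ` cyclic (+ `q` odd,
resp. `3 ∤ q`, `3 ∤ |(ℤ/q)ˣ|`); Mathlib's `ZMod.isCyclic_units_of_prime_pow` discharges this for `q = p^k`, `p` an odd prime,
giving the levels `4p^k` (e.g. `36, 100, 108, 196`) and `9p^k` with `p ≡ 2 (mod 3)` odd (e.g. `45, 99, 225`):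

* `not_periodLatticeGamma1_eq_two_mul_of_four_mul_prime_pow` / `…_three_mul_of_nine_mul_prime_pow` — no index `4` / `9`;
* `stevens_eq_optimal_of_no_Ψ₂Sq_root_four_mul_prime_pow` (any model: `E₀(ℚ)[2] = 0 ⟹ Λ₁ = Λ₀ ∧ |c₀| = |c₁|`),
  `velu_two_of_doubled_four_mul_prime_pow` (doubling ⟹ Vélu rigidity), `natAbs_maninConstant₀_eq_of_allBlind_of_four_mul_prime_pow`
  (E-an-66), `shimuraLedgerAtFour_of_four_mul_prime_pow` (E-an-67);
* `stevens_eq_optimal_of_noRationalThreeIsogeny_nine_mul_prime_pow`, `velu_three_of_tripled_nine_mul_prime_pow`.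

HONEST FRAMING: structure only; C2, C3, Manin's conjecture and BSD are not proved.  No definitions.
-/

set_option autoImplicit false
-- the summit-side namespace `Summit.BirchSwinnertonDyer.BirchSwinnertonDyer.…` is the tree's (summit = sub-problem)
set_option linter.dupNamespace false

noncomputable section

open WeierstrassCurve Literature.NumberTheory.EllipticCurves Literature.NumberTheory.EllipticCurves.ModularForms
open CongruenceSubgroup Polynomial
open Summit.BirchSwinnertonDyer.Rank1Residual.ManinAdditive.ShimuraLedger

namespace Summit.BirchSwinnertonDyer.BirchSwinnertonDyer.Theorems.ManinLocalTwoThree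

variable {W₁ W₀ : WeierstrassCurve ℚ} [W₁.IsElliptic] [W₁.IsGloballyMinimal] [W₀.IsElliptic]
  [W₀.IsGloballyMinimal]

/-! ### `N = 4p^k`, `p` an odd prime -/

omit [W₀.IsElliptic] [W₀.IsGloballyMinimal] in
/-- **No index `4` at `N = 4p^k`** (`p` an odd prime, `k` arbitrary). -/
theorem not_periodLatticeGamma1_eq_two_mul_of_four_mul_prime_pow {p : ℕ} (hp : p.Prime) (hp2 : p ≠ 2) (k : ℕ)
    [NeZero (4 * p ^ k)] (D₀ : ModularParametrizationData W₀ (4 * p ^ k))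
    (h₀ : ∀ z ∈ D₀.L.lattice, ∃ w ∈ periodLattice D₀.f, z = D₀.c * w) :
    ¬ (∀ z : ℂ, z ∈ periodLatticeGamma1 D₀.f ↔ ∃ w ∈ periodLattice D₀.f, z = 2 * w) := by
  haveI : IsCyclic (ZMod (p ^ k))ˣ := ZMod.isCyclic_units_of_prime_pow p hp hp2 k
  exact not_periodLatticeGamma1_eq_two_mul_of_four_mul ((hp.odd_of_ne_two hp2).pow) D₀ h₀

/-- **At `N = 4p^k`, any model: `W₀.Ψ₂Sq` without rational root ⟹ `Λ₁(f) = Λ₀(f)` and `|c₀| = |c₁|`.** -/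
theorem stevens_eq_optimal_of_no_Ψ₂Sq_root_four_mul_prime_pow {p : ℕ} (hp : p.Prime) (hp2 : p ≠ 2) (k : ℕ)
    [NeZero (4 * p ^ k)] (D₁ : Gamma1ParametrizationData W₁ (4 * p ^ k)) (D₀ : ModularParametrizationData W₀ (4 * p ^ k))
    (hiso : IsIsogenous W₁ W₀) (h₁ : D₁.IsOptimal)
    (h₀ : ∀ z ∈ D₀.L.lattice, ∃ w ∈ periodLattice D₀.f, z = D₀.c * w) (hno : ∀ x : ℚ, W₀.Ψ₂Sq.eval x ≠ 0) :
    periodLatticeGamma1 D₀.f = periodLattice D₀.f ∧ D₀.maninConstant.natAbs = D₁.maninConstant.natAbs := by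
  haveI : IsCyclic (ZMod (p ^ k))ˣ := ZMod.isCyclic_units_of_prime_pow p hp hp2 k
  exact stevens_eq_optimal_of_no_Ψ₂Sq_root_four_mul ((hp.odd_of_ne_two hp2).pow) D₁ D₀ hiso h₁ h₀ hno

/-- **At `N = 4p^k`: doubling forces Vélu rigidity (any model).** -/
theorem velu_two_of_doubled_four_mul_prime_pow {p : ℕ} (hp : p.Prime) (hp2 : p ≠ 2) (k : ℕ) [NeZero (4 * p ^ k)]
    (D₁ : Gamma1ParametrizationData W₁ (4 * p ^ k)) (D₀ : ModularParametrizationData W₀ (4 * p ^ k))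
    (hiso : IsIsogenous W₁ W₀) (h₁ : D₁.IsOptimal)
    (h₀ : ∀ z ∈ D₀.L.lattice, ∃ w ∈ periodLattice D₀.f, z = D₀.c * w)
    (hdouble : D₀.maninConstant.natAbs = 2 * D₁.maninConstant.natAbs) :
    ∃ q : ℚ, W₀.Ψ₂Sq.eval (q - W₀.b₂ / 12) = 0 ∧ W₁.c₄ = 720 * q ^ 2 - 4 * W₀.c₄ ∧
      W₁.c₆ = 19008 * q ^ 3 - 144 * W₀.c₄ * q := by
  rcases index_four_or_velu_two_of_doubled D₁ D₀ hiso h₁ h₀ ⟨p ^ k, rfl⟩ hdouble with h | h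
  · exact absurd h (not_periodLatticeGamma1_eq_two_mul_of_four_mul_prime_pow hp hp2 k D₀ h₀)
  · exact h

/-- **E-an-66 at `N = 4p^k`**: a totally blind optimal `W₀ = [0, a₂, 0, a₄, a₆]` has `|c₀| = |c₁|`. -/
theorem natAbs_maninConstant₀_eq_of_allBlind_of_four_mul_prime_pow {p : ℕ} (hp : p.Prime) (hp2 : p ≠ 2) (k : ℕ)
    [NeZero (4 * p ^ k)] (D₁ : Gamma1ParametrizationData W₁ (4 * p ^ k)) (D₀ : ModularParametrizationData W₀ (4 * p ^ k))
    (hiso : IsIsogenous W₁ W₀) (h₁ : D₁.IsOptimal)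
    (h₀ : ∀ z ∈ D₀.L.lattice, ∃ w ∈ periodLattice D₀.f, z = D₀.c * w)
    (ha₁ : W₀.a₁ = 0) (ha₃ : W₀.a₃ = 0) (hblind : AllRationalTwoTorsionBlind W₀) :
    D₀.maninConstant.natAbs = D₁.maninConstant.natAbs := by
  haveI : IsCyclic (ZMod (p ^ k))ˣ := ZMod.isCyclic_units_of_prime_pow p hp hp2 k
  exact natAbs_maninConstant₀_eq_of_allBlind_of_four_mul ((hp.odd_of_ne_two hp2).pow) D₁ D₀ hiso h₁ h₀ ha₁ ha₃ hblind

/-- **E-an-67 at `N = 4p^k`**: `|c₀| = |c₁|`, or `|c₀| = 2|c₁|` with a NON-blind rational `2`-torsion point. -/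
theorem shimuraLedgerAtFour_of_four_mul_prime_pow {p : ℕ} (hp : p.Prime) (hp2 : p ≠ 2) (k : ℕ) [NeZero (4 * p ^ k)]
    (D₁ : Gamma1ParametrizationData W₁ (4 * p ^ k)) (D₀ : ModularParametrizationData W₀ (4 * p ^ k))
    (hiso : IsIsogenous W₁ W₀) (h₁ : D₁.IsOptimal)
    (h₀ : ∀ z ∈ D₀.L.lattice, ∃ w ∈ periodLattice D₀.f, z = D₀.c * w) (ha₁ : W₀.a₁ = 0) (ha₃ : W₀.a₃ = 0) :
    D₀.maninConstant.natAbs = D₁.maninConstant.natAbs ∨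
      (D₀.maninConstant.natAbs = 2 * D₁.maninConstant.natAbs ∧ HasNonBlindRationalTwoTorsion W₀) := by
  haveI : IsCyclic (ZMod (p ^ k))ˣ := ZMod.isCyclic_units_of_prime_pow p hp hp2 k
  exact shimuraLedgerAtFour_of_four_mul ((hp.odd_of_ne_two hp2).pow) D₁ D₀ hiso h₁ h₀ ha₁ ha₃

/-! ### `N = 9p^k`, `p` an odd prime `≡ 2 (mod 3)` -/

/-- For an odd prime `p ≡ 2 (mod 3)`: `3 ∤ p^k` and `3 ∤ |(ℤ/p^k)ˣ| = φ(p^k)`. -/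
theorem coprime_three_card_units_prime_pow {p : ℕ} (hp : p.Prime) (hp3 : p % 3 = 2) (k : ℕ) [NeZero (p ^ k)] :
    Nat.Coprime 3 (p ^ k) ∧ Nat.Coprime 3 (Fintype.card (ZMod (p ^ k))ˣ) := by
  have h3p : Nat.Coprime 3 p := (Nat.coprime_primes Nat.prime_three hp).2 (by rintro rfl; norm_num at hp3)
  have h3p1 : Nat.Coprime 3 (p - 1) := by
    have h1 : (p - 1) % 3 = 1 := by have := hp.two_le; omega
    rw [Nat.Coprime, Nat.gcd_rec, h1]
    rfl
  refine ⟨h3p.pow_right k, ?_⟩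
  rw [ZMod.card_units_eq_totient]
  rcases Nat.eq_zero_or_pos k with rfl | hk
  · simp
  · rw [Nat.totient_prime_pow hp hk]
    exact (h3p.pow_right _).mul_right h3p1

omit [W₀.IsElliptic] [W₀.IsGloballyMinimal] in
/-- **No index `9` at `N = 9p^k`** (`p` an odd prime `≡ 2 (mod 3)`). -/
theorem not_periodLatticeGamma1_eq_three_mul_of_nine_mul_prime_pow {p : ℕ} (hp : p.Prime) (hp2 : p ≠ 2)
    (hp3 : p % 3 = 2) (k : ℕ) [NeZero (9 * p ^ k)] (D₀ : ModularParametrizationData W₀ (9 * p ^ k))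
    (h₀ : ∀ z ∈ D₀.L.lattice, ∃ w ∈ periodLattice D₀.f, z = D₀.c * w) :
    ¬ (∀ z : ℂ, z ∈ periodLatticeGamma1 D₀.f ↔ ∃ w ∈ periodLattice D₀.f, z = 3 * w) := by
  haveI : NeZero (p ^ k) := ⟨pow_ne_zero k hp.ne_zero⟩
  haveI : IsCyclic (ZMod (p ^ k))ˣ := ZMod.isCyclic_units_of_prime_pow p hp hp2 k
  obtain ⟨hq, hcard⟩ := coprime_three_card_units_prime_pow hp hp3 k
  exact not_periodLatticeGamma1_eq_three_mul_of_nine_mul hq hcard D₀ h₀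

/-- **At `N = 9p^k` (`p` odd, `≡ 2 (mod 3)`): no rational `3`-isogeny ⟹ `Λ₁(f) = Λ₀(f)` and `|c₀| = |c₁|`.** -/
theorem stevens_eq_optimal_of_noRationalThreeIsogeny_nine_mul_prime_pow {p : ℕ} (hp : p.Prime) (hp2 : p ≠ 2)
    (hp3 : p % 3 = 2) (k : ℕ) [NeZero (9 * p ^ k)]
    (D₁ : Gamma1ParametrizationData W₁ (9 * p ^ k)) (D₀ : ModularParametrizationData W₀ (9 * p ^ k))
    (hiso : IsIsogenous W₁ W₀) (h₁ : D₁.IsOptimal)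
    (h₀ : ∀ z ∈ D₀.L.lattice, ∃ w ∈ periodLattice D₀.f, z = D₀.c * w) (hno : ∀ x : ℚ, W₀.Ψ₃.eval x ≠ 0) :
    periodLatticeGamma1 D₀.f = periodLattice D₀.f ∧ D₀.maninConstant.natAbs = D₁.maninConstant.natAbs := by
  haveI : NeZero (p ^ k) := ⟨pow_ne_zero k hp.ne_zero⟩
  haveI : IsCyclic (ZMod (p ^ k))ˣ := ZMod.isCyclic_units_of_prime_pow p hp hp2 k
  obtain ⟨hq, hcard⟩ := coprime_three_card_units_prime_pow hp hp3 k
  exact stevens_eq_optimal_of_noRationalThreeIsogeny_nine_mul hq hcard D₁ D₀ hiso h₁ h₀ hno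

/-- **At `N = 9p^k` (`p` odd, `≡ 2 (mod 3)`): tripling forces Vélu rigidity at `3`.** -/
theorem velu_three_of_tripled_nine_mul_prime_pow {p : ℕ} (hp : p.Prime) (hp2 : p ≠ 2) (hp3 : p % 3 = 2) (k : ℕ)
    [NeZero (9 * p ^ k)] (D₁ : Gamma1ParametrizationData W₁ (9 * p ^ k)) (D₀ : ModularParametrizationData W₀ (9 * p ^ k))
    (hiso : IsIsogenous W₁ W₀) (h₁ : D₁.IsOptimal)
    (h₀ : ∀ z ∈ D₀.L.lattice, ∃ w ∈ periodLattice D₀.f, z = D₀.c * w)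
    (htri : D₀.maninConstant.natAbs = 3 * D₁.maninConstant.natAbs) :
    ∃ q : ℚ, W₀.Ψ₃.eval (q - W₀.b₂ / 12) = 0 ∧ W₁.c₄ = 1440 * q ^ 2 - 9 * W₀.c₄ ∧
      W₁.c₆ = 60480 * q ^ 3 - 756 * W₀.c₄ * q - 27 * W₀.c₆ := by
  rcases index_nine_or_velu_three_of_tripled D₁ D₀ hiso h₁ h₀ ⟨p ^ k, rfl⟩ htri with h | h
  · exact absurd h (not_periodLatticeGamma1_eq_three_mul_of_nine_mul_prime_pow hp hp2 hp3 k D₀ h₀)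
  · exact h

end Summit.BirchSwinnertonDyer.BirchSwinnertonDyer.Theorems.ManinLocalTwoThree

end
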